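import Summits.AnomalousDissipation.AnomalousDissipation.Theses.EnsembleRigidity
import Summits.AnomalousDissipation.AnomalousDissipation.Theorems.GPMeanBoundedFamily.Negative.LevelFloor
import Summits.AnomalousDissipation.AnomalousDissipation.Theorems.GPMeanBoundedFamily.Negative.AmplitudeIntegralBounds
import Literature.Analysis.FluidPDE.EnergySpaceTorusHilbertBasisProofs
import Literature.Analysis.FluidPDE.TorusForceBookkeeping
import Literature.Analysis.FunctionSpaces.TorusFourierCalculus
import Literature.Analysis.FunctionSpaces.TorusTestFunction

/-!
# The explicit Doering–Foias level of `f_GP`: every witness of `GPMeanBoundedFamily` has `E ≥ 3/(4π)`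

cdisprove seat `refuter-cdisprove-stmt-AnomalousDissipation-15509-0` (stmt-AnomalousDissipation-15509, cycle 1),
sharpening `Negative/LevelFloor.lean` (non-explicit `e₀`).

Test the momentum equation of a global Leray–Hopf solution of NS_ν(f_GP) against the unit multiplier
`Ψ = (2/3)^{1/2} f_GP` (Cheskidov–Doering–Petrov 2007 eq. (18) with `ψ = Φ`).  The convective term has the
SHARP pointwise bound `|⟪U, (U·∇)Ψ⟫| ≤ 2π (2/3)^{1/2} ‖U‖²` (`(U·∇)f_GP = 2π (U₂cos 2πx₂, U₀cos 2πx₀,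
U₁cos 2πx₁)`), whence for EVERY global Leray–Hopf solution `u` of NS_ν(f_GP), `ν > 0`, any datum,

  `3/2 ≤ 2π ⟨‖u‖₂²⟩ + ν K ⟨‖u‖₂²⟩^{1/2}`   (`meanEnergy_gp_lower_bound`; `K` depends on f_GP only),

and therefore every witness `(E, ν_j → 0, u_j)` of the crux has **`E ≥ 3/(4π) ≈ 0.2387`**
(`level_ge_three_div_four_pi`): the strengthening of `GPMeanBoundedFamily` to any level `E < 3/(4π)` is false
(`not_below_three_div_four_pi`).  (Compare: symmetric Galerkin / DNS equilibrium energy at ν = 1/20 is 0.248.)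

The general amplitude bound with an integrated convective hypothesis is `Negative/AmplitudeIntegralBounds.lean`.
-/

noncomputable section

open MeasureTheory Filter Set Function Topology
open scoped RealInnerProductSpace ENNReal NNReal

namespace Summit.AnomalousDissipation.AnomalousDissipation.Theorems.GPMeanBoundedFamily.Negative

open Literature.Analysis Literature.Analysis.FunctionSpaces Literature.Analysis.FluidPDE

/-! ### The sharp convective bound for the Galloway–Proctor multiplier -/

section GP

/-- `∂ⱼ (Im e_k • a) = (2π kⱼ Re e_k) • a` for a sine Stokes mode. [folklore] -/
private theorem partialDeriv_sinMode (k : Fin 3 → ℤ) (a : EuclideanSpace ℝ (Fin 3)) (j : Fin 3)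
    (x : UnitAddTorus (Fin 3)) :
    Torus.partialDeriv j (⇑(Torus.stokesMode k a false)) x =
      (2 * Real.pi * (k j : ℝ) * (UnitAddTorus.mFourier k x).re) • a := by
  have e : (⇑(Torus.stokesMode k a false) : UnitAddTorus (Fin 3) → EuclideanSpace ℝ (Fin 3)) =
      ⇑(Complex.imCLM.smulRight a) ∘ ⇑(UnitAddTorus.mFourier k) := by
    funext y
    simp [Torus.stokesMode_apply]
  rw [e, Torus.partialDeriv_clm_comp (Torus.isSmooth_mFourier k) _ j x, Torus.partialDeriv_mFourier,
    ContinuousLinearMap.smulRight_apply, Complex.imCLM_apply]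
  congr 1
  simp

/-- Convective derivative along `U` of a sine Stokes mode: `(U·∇)(Im e_k • a) = (2π Re e_k ∑ⱼ kⱼ Uⱼ) • a`. [folklore] -/
private theorem convect_sinMode (U : UnitAddTorus (Fin 3) → EuclideanSpace ℝ (Fin 3)) (k : Fin 3 → ℤ)
    (a : EuclideanSpace ℝ (Fin 3)) (x : UnitAddTorus (Fin 3)) :
    Torus.convect U (⇑(Torus.stokesMode k a false)) x =
      (2 * Real.pi * (UnitAddTorus.mFourier k x).re * ∑ j, (k j : ℝ) * U x j) • a := by
  have hs : Torus.IsContDiff 1 (⇑(Torus.stokesMode k a false) : UnitAddTorus (Fin 3) → EuclideanSpace ℝ (Fin 3)) :=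
    (Torus.isSmooth_stokesMode k a false).isContDiff (by simp)
  unfold Torus.convect
  rw [Torus.fderiv_apply_eq_sum_partialDeriv hs]
  simp_rw [partialDeriv_sinMode, smul_smul, ← Finset.sum_smul]
  congr 1
  rw [Finset.mul_sum]
  refine Finset.sum_congr rfl fun j _ => ?_
  ring

/-- `|Re e_k(x)| ≤ 1`. [folklore] -/
private theorem abs_re_mFourier_le (k : Fin 3 → ℤ) (x : UnitAddTorus (Fin 3)) :
    |(UnitAddTorus.mFourier k x).re| ≤ 1 :=
  (Complex.abs_re_le_norm _).trans (((UnitAddTorus.mFourier k).norm_coe_le_norm x).trans_eq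
    UnitAddTorus.mFourier_norm)

/-- **The sharp convective bound for `f_GP`**: for every field `U` and point `x`,
`|⟪U, (U·∇) f_GP⟫| ≤ 2π ‖U‖²` (`(U·∇)f_GP = 2π(U₂ cos2πx₂, U₀ cos2πx₀, U₁ cos2πx₁)` has norm `≤ 2π‖U‖`). [folklore] -/
theorem abs_inner_convect_gpForce_le (U : UnitAddTorus (Fin 3) → EuclideanSpace ℝ (Fin 3))
    (x : UnitAddTorus (Fin 3)) :
    |⟪U x, Torus.convect U (fun y : UnitAddTorus (Fin 3) =>
      (Torus.stokesMode (Pi.single (2 : Fin 3) (1 : ℤ)) (EuclideanSpace.single (0 : Fin 3) (1 : ℝ)) false y +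
        Torus.stokesMode (Pi.single (0 : Fin 3) (1 : ℤ)) (EuclideanSpace.single (1 : Fin 3) (1 : ℝ)) false y +
        Torus.stokesMode (Pi.single (1 : Fin 3) (1 : ℤ)) (EuclideanSpace.single (2 : Fin 3) (1 : ℝ)) false y :
        EuclideanSpace ℝ (Fin 3))) x⟫| ≤ 2 * Real.pi * ‖U x‖ ^ 2 := by
  set s₁ := (⇑(Torus.stokesMode (Pi.single (2 : Fin 3) (1 : ℤ)) (EuclideanSpace.single (0 : Fin 3) (1 : ℝ)) false) :
    UnitAddTorus (Fin 3) → EuclideanSpace ℝ (Fin 3)) with hs₁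
  set s₂ := (⇑(Torus.stokesMode (Pi.single (0 : Fin 3) (1 : ℤ)) (EuclideanSpace.single (1 : Fin 3) (1 : ℝ)) false) :
    UnitAddTorus (Fin 3) → EuclideanSpace ℝ (Fin 3)) with hs₂
  set s₃ := (⇑(Torus.stokesMode (Pi.single (1 : Fin 3) (1 : ℤ)) (EuclideanSpace.single (2 : Fin 3) (1 : ℝ)) false) :
    UnitAddTorus (Fin 3) → EuclideanSpace ℝ (Fin 3)) with hs₃
  have h₁ : Torus.IsContDiff 1 s₁ := (Torus.isSmooth_stokesMode _ _ _).isContDiff (by simp)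
  have h₂ : Torus.IsContDiff 1 s₂ := (Torus.isSmooth_stokesMode _ _ _).isContDiff (by simp)
  have h₃ : Torus.IsContDiff 1 s₃ := (Torus.isSmooth_stokesMode _ _ _).isContDiff (by simp)
  have hsum : (fun y : UnitAddTorus (Fin 3) => (s₁ y + s₂ y + s₃ y : EuclideanSpace ℝ (Fin 3))) = s₁ + s₂ + s₃ := by
    funext y; simp
  -- linearity of the convective derivative in the transported field
  have hlin : Torus.convect U (s₁ + s₂ + s₃) x = Torus.convect U s₁ x + Torus.convect U s₂ x + Torus.convect U s₃ x := by
    unfold Torus.convect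
    rw [Torus.fderiv_add (h₁.add h₂) h₃, Torus.fderiv_add h₁ h₂]
    rfl
  -- closed form of the convective derivative
  have hconv : Torus.convect U (fun y : UnitAddTorus (Fin 3) => (s₁ y + s₂ y + s₃ y : EuclideanSpace ℝ (Fin 3))) x =
      (2 * Real.pi * (UnitAddTorus.mFourier (Pi.single (2 : Fin 3) (1 : ℤ)) x).re * U x 2) •
          EuclideanSpace.single (0 : Fin 3) (1 : ℝ) +
        (2 * Real.pi * (UnitAddTorus.mFourier (Pi.single (0 : Fin 3) (1 : ℤ)) x).re * U x 0) •
          EuclideanSpace.single (1 : Fin 3) (1 : ℝ) +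
        (2 * Real.pi * (UnitAddTorus.mFourier (Pi.single (1 : Fin 3) (1 : ℤ)) x).re * U x 1) •
          EuclideanSpace.single (2 : Fin 3) (1 : ℝ) := by
    rw [hsum, hlin, hs₁, hs₂, hs₃, convect_sinMode, convect_sinMode, convect_sinMode]
    simp [Pi.single_apply]
  -- the three cosines
  set c₁ := (UnitAddTorus.mFourier (Pi.single (2 : Fin 3) (1 : ℤ)) x).re with hc₁
  set c₂ := (UnitAddTorus.mFourier (Pi.single (0 : Fin 3) (1 : ℤ)) x).re with hc₂
  set c₃ := (UnitAddTorus.mFourier (Pi.single (1 : Fin 3) (1 : ℤ)) x).re with hc₃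
  have hb₁ : |c₁| ≤ 1 := abs_re_mFourier_le _ _
  have hb₂ : |c₂| ≤ 1 := abs_re_mFourier_le _ _
  have hb₃ : |c₃| ≤ 1 := abs_re_mFourier_le _ _
  -- inner product with `U` and the bound `|ab| + |bc| + |ca| ≤ a² + b² + c²`-free estimate via the norm
  rw [hconv]
  set a := U x 0 with ha
  set b := U x 1 with hb
  set c := U x 2 with hc
  have hnormsq : ‖U x‖ ^ 2 = a ^ 2 + b ^ 2 + c ^ 2 := by
    rw [EuclideanSpace.norm_sq_eq, Fin.sum_univ_three]
    simp [ha, hb, hc, Real.norm_eq_abs, sq_abs]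
  have hinner : ⟪U x, (2 * Real.pi * c₁ * c) • EuclideanSpace.single (0 : Fin 3) (1 : ℝ) +
        (2 * Real.pi * c₂ * a) • EuclideanSpace.single (1 : Fin 3) (1 : ℝ) +
        (2 * Real.pi * c₃ * b) • EuclideanSpace.single (2 : Fin 3) (1 : ℝ)⟫ =
      2 * Real.pi * (c₁ * (a * c) + c₂ * (a * b) + c₃ * (b * c)) := by
    simp only [inner_add_right, inner_smul_right, EuclideanSpace.inner_single_right]
    simp [ha, hb, hc]
    ring
  rw [hinner, abs_mul, abs_of_pos (by positivity : (0 : ℝ) < 2 * Real.pi), hnormsq]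
  refine mul_le_mul_of_nonneg_left ?_ (by positivity)
  have e1 : |c₁ * (a * c)| ≤ |a * c| := by
    rw [abs_mul]; exact (mul_le_of_le_one_left (abs_nonneg _) hb₁)
  have e2 : |c₂ * (a * b)| ≤ |a * b| := by
    rw [abs_mul]; exact (mul_le_of_le_one_left (abs_nonneg _) hb₂)
  have e3 : |c₃ * (b * c)| ≤ |b * c| := by
    rw [abs_mul]; exact (mul_le_of_le_one_left (abs_nonneg _) hb₃)
  have hac : |a * c| ≤ (a ^ 2 + c ^ 2) / 2 := by
    rw [abs_mul]; nlinarith [sq_abs a, sq_abs c, sq_nonneg (|a| - |c|), abs_nonneg a, abs_nonneg c]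
  have hab : |a * b| ≤ (a ^ 2 + b ^ 2) / 2 := by
    rw [abs_mul]; nlinarith [sq_abs a, sq_abs b, sq_nonneg (|a| - |b|), abs_nonneg a, abs_nonneg b]
  have hbc : |b * c| ≤ (b ^ 2 + c ^ 2) / 2 := by
    rw [abs_mul]; nlinarith [sq_abs b, sq_abs c, sq_nonneg (|b| - |c|), abs_nonneg b, abs_nonneg c]
  calc |c₁ * (a * c) + c₂ * (a * b) + c₃ * (b * c)|
      ≤ |c₁ * (a * c)| + |c₂ * (a * b)| + |c₃ * (b * c)| := abs_add_three _ _ _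
    _ ≤ a ^ 2 + b ^ 2 + c ^ 2 := by linarith

/-- **Explicit Doering–Foias inequality for `f_GP`.** There is `K ≥ 0` (depending on `f_GP` only) such that
every global Leray–Hopf solution `u` of NS_ν(f_GP), `ν > 0`, ANY datum, obeys
`3/2 ≤ 2π ⟨‖u‖₂²⟩ + ν K ⟨‖u‖₂²⟩^{1/2}` (`⟨‖u‖₂²⟩ = meanEnergy u`): multiplier `Ψ = (2/3)^{1/2} f_GP`, sharp
convective constant `2π(2/3)^{1/2}`, amplitude `F = (3/2)^{1/2}`. [cite: CheskidovDoeringPetrov2006, §III eq. (18)] -/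
theorem meanEnergy_gp_lower_bound : ∃ K : ℝ, 0 ≤ K ∧ ∀ (ν : ℝ) (u₀ : UnitAddTorus (Fin 3) → EuclideanSpace ℝ (Fin 3))
    (u : ℝ → UnitAddTorus (Fin 3) → EuclideanSpace ℝ (Fin 3)), 0 < ν →
    Torus.IsGlobalLerayHopf ν (fun _ => (fun x : UnitAddTorus (Fin 3) =>
      (Torus.stokesMode (Pi.single (2 : Fin 3) (1 : ℤ)) (EuclideanSpace.single (0 : Fin 3) (1 : ℝ)) false x +
        Torus.stokesMode (Pi.single (0 : Fin 3) (1 : ℤ)) (EuclideanSpace.single (1 : Fin 3) (1 : ℝ)) false x +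
        Torus.stokesMode (Pi.single (1 : Fin 3) (1 : ℤ)) (EuclideanSpace.single (2 : Fin 3) (1 : ℝ)) false x :
        EuclideanSpace ℝ (Fin 3)))) u₀ u →
    3 / 2 ≤ 2 * Real.pi * meanEnergy u + ν * K * Real.sqrt (meanEnergy u) := by
  -- the forcing shape `Φ_GP = (2/3)^{1/2} • f_GP`
  set f : UnitAddTorus (Fin 3) → EuclideanSpace ℝ (Fin 3) := fun x : UnitAddTorus (Fin 3) =>
      (Torus.stokesMode (Pi.single (2 : Fin 3) (1 : ℤ)) (EuclideanSpace.single (0 : Fin 3) (1 : ℝ)) false x +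
        Torus.stokesMode (Pi.single (0 : Fin 3) (1 : ℤ)) (EuclideanSpace.single (1 : Fin 3) (1 : ℝ)) false x +
        Torus.stokesMode (Pi.single (1 : Fin 3) (1 : ℤ)) (EuclideanSpace.single (2 : Fin 3) (1 : ℝ)) false x :
        EuclideanSpace ℝ (Fin 3)) with hf
  obtain ⟨hsm, hdf, hzm⟩ :=
    Summit.AnomalousDissipation.AnomalousDissipation.Theorems.SteadyStatesLoudBounded.GpAdmissible.stub_gpAdmissible
  have hnorm : ∫ x, ‖(Real.sqrt (2 / 3) • f) x‖ ^ 2 = 1 := by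
    have h : ∀ x, ‖(Real.sqrt (2 / 3) • f) x‖ ^ 2 = (2 / 3) * ‖f x‖ ^ 2 := fun x => by
      rw [Pi.smul_apply, norm_smul, mul_pow, Real.norm_eq_abs, sq_abs,
        Real.sq_sqrt (by norm_num : (0 : ℝ) ≤ 2 / 3)]
    simp_rw [h]
    rw [integral_const_mul, hf, integral_norm_sq_gpForce]
    norm_num
  set Φ : ForcingShape (Fin 3) := ⟨Real.sqrt (2 / 3) • f, hsm.smul _,
    Torus.isDivFree_const_smul (hsm.isContDiff (by simp)) hdf _, Torus.hasZeroMean_const_smul hzm _, hnorm⟩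
    with hΦ
  set F : ℝ := Real.sqrt (3 / 2) with hF
  have hFpos : 0 < F := Real.sqrt_pos.mpr (by norm_num)
  have hforce : Φ.force 1 F = f := by
    funext x
    simp only [ForcingShape.force, hΦ, one_nsmul, Pi.smul_apply, smul_smul]
    rw [← Real.sqrt_mul (by norm_num : (0 : ℝ) ≤ 3 / 2), show (3 / 2 : ℝ) * (2 / 3) = 1 by norm_num,
      Real.sqrt_one, one_smul]
  have hforce1 : Φ.force 1 1 = Real.sqrt (2 / 3) • f := by
    funext x
    simp [ForcingShape.force, hΦ]
  -- the sharp convective bound for `Ψ = (2/3)^{1/2} f_GP`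
  set C : ℝ := 2 * Real.pi * Real.sqrt (2 / 3) with hC
  have hC0 : 0 ≤ C := by positivity
  have hconv : ∀ U : UnitAddTorus (Fin 3) → EuclideanSpace ℝ (Fin 3), MemLp U 2 volume →
      |∫ x, ⟪U x, Torus.convect U (Φ.force 1 1) x⟫| ≤ C * ∫ x, ‖U x‖ ^ 2 := by
    intro U hU
    have hpt : ∀ x, |⟪U x, Torus.convect U (Φ.force 1 1) x⟫| ≤ C * ‖U x‖ ^ 2 := by
      intro x
      rw [hforce1, show (Real.sqrt (2 / 3) • f) = fun y => Real.sqrt (2 / 3) • f y from rfl,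
        Torus.convect_const_smul U (hsm.isContDiff (by simp)), inner_smul_right, abs_mul,
        abs_of_nonneg (Real.sqrt_nonneg _), hC]
      have h := abs_inner_convect_gpForce_le U x
      calc Real.sqrt (2 / 3) * |⟪U x, Torus.convect U f x⟫| ≤ Real.sqrt (2 / 3) * (2 * Real.pi * ‖U x‖ ^ 2) :=
            mul_le_mul_of_nonneg_left h (Real.sqrt_nonneg _)
        _ = 2 * Real.pi * Real.sqrt (2 / 3) * ‖U x‖ ^ 2 := by ring
    rw [← integral_const_mul]
    refine abs_integral_le_integral_abs.trans (integral_mono_of_nonneg (ae_of_all _ fun x => abs_nonneg _)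
      ((hU.integrable_norm_pow two_ne_zero).const_mul C) (ae_of_all _ fun x => hpt x))
  -- the Laplacian of the multiplier is bounded (crude, from the tree)
  obtain ⟨M, hM0, hM⟩ := exists_norm_laplacian_force_le Φ
  have hL : ∀ x, ‖Torus.laplacian (Φ.force 1 1) x‖ ≤ M := fun x => by simpa using hM 1 1 x
  refine ⟨M * F, mul_nonneg hM0 hFpos.le, fun ν u₀ u hν hu => ?_⟩
  have hu' : Torus.IsGlobalLerayHopf ν (fun _ => Φ.force 1 F) u₀ u := by rwa [hforce]
  have key := abs_amplitude_le_of_integralBounds hν one_pos hu' hC0 hM0 hconv hL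
  rw [abs_of_pos hFpos] at key
  -- `U² = meanEnergy u`, multiply by `F`: `F² = 3/2`, `F C = 2π`
  have hUsq : rmsVelocity longTimeAvgSup u ^ 2 = meanEnergy u := Real.sq_sqrt (meanEnergy_nonneg u)
  have hUeq : rmsVelocity longTimeAvgSup u = Real.sqrt (meanEnergy u) := rfl
  have hF2 : F * F = 3 / 2 := by rw [hF, Real.mul_self_sqrt (by norm_num : (0 : ℝ) ≤ 3 / 2)]
  have hFC : F * C = 2 * Real.pi := by
    rw [hF, hC, show Real.sqrt (3 / 2) * (2 * Real.pi * Real.sqrt (2 / 3)) =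
      2 * Real.pi * (Real.sqrt (3 / 2) * Real.sqrt (2 / 3)) by ring, ← Real.sqrt_mul (by norm_num : (0 : ℝ) ≤ 3 / 2),
      show (3 / 2 : ℝ) * (2 / 3) = 1 by norm_num, Real.sqrt_one, mul_one]
  have h2 := mul_le_mul_of_nonneg_left key hFpos.le
  calc (3 / 2 : ℝ) = F * F := hF2.symm
    _ ≤ F * (C * rmsVelocity longTimeAvgSup u ^ 2 + ν * M * rmsVelocity longTimeAvgSup u) := h2
    _ = 2 * Real.pi * meanEnergy u + ν * (M * F) * Real.sqrt (meanEnergy u) := by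
        rw [mul_add, ← mul_assoc, hFC, hUsq, hUeq]; ring

/-- **Every witness of `GPMeanBoundedFamily` has level `E ≥ 3/(4π)`** (`≈ 0.2387`): from
`3/2 ≤ 2π E + ν_j K E^{1/2}` for all `j` and `ν_j → 0`.  Uses only the viscosity-positivity, vanishing,
Leray–Hopf and mean-energy clauses (the lift is not needed). [folklore] -/
theorem level_ge_three_div_four_pi (E : ℝ) (ν : ℕ → ℝ)
    (u₀ : ℕ → UnitAddTorus (Fin 3) → EuclideanSpace ℝ (Fin 3)) (u : ℕ → ℝ → UnitAddTorus (Fin 3) → EuclideanSpace ℝ (Fin 3))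
    (hν : ∀ j, 0 < ν j) (hν0 : Tendsto ν atTop (nhds 0))
    (hLH : ∀ j, Torus.IsGlobalLerayHopf (ν j) (fun _ => (fun x : UnitAddTorus (Fin 3) =>
      (Torus.stokesMode (Pi.single (2 : Fin 3) (1 : ℤ)) (EuclideanSpace.single (0 : Fin 3) (1 : ℝ)) false x +
        Torus.stokesMode (Pi.single (0 : Fin 3) (1 : ℤ)) (EuclideanSpace.single (1 : Fin 3) (1 : ℝ)) false x +
        Torus.stokesMode (Pi.single (1 : Fin 3) (1 : ℤ)) (EuclideanSpace.single (2 : Fin 3) (1 : ℝ)) false x :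
        EuclideanSpace ℝ (Fin 3)))) (u₀ j) (u j))
    (hE : ∀ j, meanEnergy (u j) ≤ E) : 3 / (4 * Real.pi) ≤ E := by
  obtain ⟨K, hK0, hbound⟩ := meanEnergy_gp_lower_bound
  have hE0 : 0 ≤ E := (meanEnergy_nonneg (u 0)).trans (hE 0)
  have hpi : 0 < Real.pi := Real.pi_pos
  -- for every `j`: `3/2 ≤ 2π E + ν_j K √E`
  have hj : ∀ j, 3 / 2 ≤ 2 * Real.pi * E + ν j * K * Real.sqrt E := fun j => by
    have h := hbound (ν j) (u₀ j) (u j) (hν j) (hLH j)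
    have h1 : 2 * Real.pi * meanEnergy (u j) ≤ 2 * Real.pi * E := mul_le_mul_of_nonneg_left (hE j) (by positivity)
    have h2 : ν j * K * Real.sqrt (meanEnergy (u j)) ≤ ν j * K * Real.sqrt E :=
      mul_le_mul_of_nonneg_left (Real.sqrt_le_sqrt (hE j)) (mul_nonneg (hν j).le hK0)
    linarith
  -- let `j → ∞`
  have hlim : Tendsto (fun j => 2 * Real.pi * E + ν j * K * Real.sqrt E) atTop (𝓝 (2 * Real.pi * E + 0 * K * Real.sqrt E)) :=
    tendsto_const_nhds.add ((hν0.mul_const K).mul_const (Real.sqrt E))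
  rw [zero_mul, zero_mul, add_zero] at hlim
  have hge : 3 / 2 ≤ 2 * Real.pi * E := ge_of_tendsto' hlim hj
  rw [div_le_iff₀ (by positivity)]
  linarith

/-- **The strengthening of the crux to any level below `3/(4π)` is false** (stated inline, no new fact):
there is NO `(ν_j → 0, u_j)` family of global Leray–Hopf solutions of NS_{ν_j}(f_GP) — lifted or not, any data —
with `meanEnergy (u_j) ≤ E` for an `E < 3/(4π)`.  In particular the body of `GPMeanBoundedFamily` with the level
fixed at `E = 0.2387` (or at the symmetric-Galerkin value `0.23` of ν = 1/20) is refuted. [folklore] -/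
theorem not_below_three_div_four_pi : ¬ ∃ (E : ℝ) (ν : ℕ → ℝ)
    (u₀ : ℕ → UnitAddTorus (Fin 3) → EuclideanSpace ℝ (Fin 3)) (u : ℕ → ℝ → UnitAddTorus (Fin 3) → EuclideanSpace ℝ (Fin 3)),
    E < 3 / (4 * Real.pi) ∧ (∀ j, 0 < ν j) ∧ Tendsto ν atTop (nhds 0) ∧
    (∀ j, Torus.IsGlobalLerayHopf (ν j) (fun _ => (fun x : UnitAddTorus (Fin 3) =>
      (Torus.stokesMode (Pi.single (2 : Fin 3) (1 : ℤ)) (EuclideanSpace.single (0 : Fin 3) (1 : ℝ)) false x +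
        Torus.stokesMode (Pi.single (0 : Fin 3) (1 : ℤ)) (EuclideanSpace.single (1 : Fin 3) (1 : ℝ)) false x +
        Torus.stokesMode (Pi.single (1 : Fin 3) (1 : ℤ)) (EuclideanSpace.single (2 : Fin 3) (1 : ℝ)) false x :
        EuclideanSpace ℝ (Fin 3)))) (u₀ j) (u j)) ∧
    ∀ j, meanEnergy (u j) ≤ E := by
  rintro ⟨E, ν, u₀, u, hElt, hν, hν0, hLH, hE⟩
  exact absurd (level_ge_three_div_four_pi E ν u₀ u hν hν0 hLH hE) (not_le.mpr hElt)

end GP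

end Summit.AnomalousDissipation.AnomalousDissipation.Theorems.GPMeanBoundedFamily.Negative
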